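import Summits.BirchSwinnertonDyer.Rank1Residual.Additive.UniversalNormTwistTransport
import Literature.NumberTheory.EllipticCurves.BSDInvariantsProofs
import Literature.NumberTheory.EllipticCurves.QuadraticTwist
import Literature.NumberTheory.EllipticCurves.QuadraticTwistSelmerPInfty
import Literature.NumberTheory.EllipticCurves.QuadraticBaseChangeGaloisProofs
import Literature.NumberTheory.EllipticCurves.Mazur1972.OrdinaryUniversalNormIndex
import Literature.NumberTheory.NumberFields.AdicCompletionSquareCriteria
import Literature.NumberTheory.GaloisRepresentations.RatPlaceTwoProofs
import Literature.NumberTheory.GaloisRepresentations.HeckeCharacterProofs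
import HarnessLib

/-!
# (T3) The twist transport of Mazur's universal norms: Steps B–D and the instance over `ℚ` —
# `2 · E(ℚ_p) ⊆ N_∞E(ℚ_p)` and `p ∤ [E(ℚ_p) : N_∞E(ℚ_p)]` for the additive twist `E = V ⊗ χ_{p*}`

HONEST FRAMING (cell `bsd-addord`, `run/shared/lean/pub/bsd-addord/README.md` §4; seat
`bsd-addord-twist`, strategy = twist transport; T-ANOM route R1 of TARGET.md (S36″/S36‴/S39/S41: «the 177
anomalous r1 keys wait on twist (T3) transport»)): the programme's target of record is the full BSD
formula for every `E/ℚ` of analytic rank `≤ 1`. This file is item (T3): a KERNEL transport lemma. It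
books nothing; its consumers are (T4): Delbourgo 2002 Theorem (B) in the INTRINSIC currency
(`Delbourgo2002.mainTheorem_intrinsic`, p404293: the factor `[E(ℚ_p) : N_∞E(ℚ_p)]/c_p` and its printed
finiteness `0 < ι`) on the additive potentially-good-ordinary rows of defect `2`, anomalous or not —
where the paper's own evaluation `= 1 or p²` (p. 70) is disputed (tree flag `Del02-ThmB-ellp-anomalous`;
referee rulings (α′)/(β′), `run/shared/lean/pub/bsd-addord/REF-tanom.md`). Theorems only; the ONE cited
input, Mazur 1972 Cor. 5.15 in the tree's form `Mazur1972.cor515_universalNormIndex` (p403746), enters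
as a HYPOTHESIS BY NAME of the two `ℚ`-theorems; no `sorry`.

## Content

Abstract setting of `UniversalNormTwistTransport.lean` (`X/K`, `d`, `E`, `θ` with `σθ = ±θ`,
`S = Stab(θ)`, `κ`, `p` odd, `ι` with its sign rule); hypotheses: `θ ∉ E` and the universal-norm indices of `X` over `E`
(`U = Γ_E`) and over `E(θ)` (`U = S`) are EQUAL to an ODD number `N₀`.
* §7.5 **Step B** (counting): every `E(θ)`-point of `X` is an `E`-point modulo `N_∞^{E(θ)}`.
* §7.6 **Step C**: for `P ∈ X^{(d)}(E)`, `ι P` (anti-invariant) is a universal norm over `E(θ)`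
  (`ι P ≡ m ≡ -ι P`, so `2 ι P ∈ N_∞^{E(θ)}`, an odd-index subgroup).
* §7.7 **Step D** = `two_nsmul_mem_localUniversalNorms_twist`: **`2 · X^{(d)}(E) ⊆ N_∞(X^{(d)}/E)`**
  (anti-symmetrise a layer-`n` preimage of `ι P` by an involution `τ_n ∈ Γ_n`; it descends to a
  `Γ_n`-fixed point of the twist whose norm is `2P`).
* §8 Over `ℚ`: `V/ℚ` globally minimal, good ORDINARY at an odd `p`, `W = C • V^{(p*)}`
  (`p* = (−1)^{(p−1)/2} p`; `W` = the additive, potentially good ordinary, defect-`2` twist), `κ`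
  cyclotomic, `v ∣ p`: `p*` is not a square in `ℚ_p` (odd valuation), Mazur's fact gives both indices
  `= p^{2e_p}` (odd), the completed square `V^{(1)} = C₁ • V` supplies the `a₁ = a₃ = 0` model, and §1's
  transport moves between `V, V^{(1)}` and `(V^{(1)})^{(p*)}, W`. Results:
  `two_nsmul_mem_localUniversalNorms_of_goodOrd_twist` (**`2 · W(ℚ_p) ⊆ N_∞W(ℚ_p)`**) and
  `not_dvd_localUniversalNormIndex_of_goodOrd_twist` (**`[W(ℚ_p) : N_∞] ≠ 0 ⇒ p ∤ [W(ℚ_p) : N_∞]`**,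
  Cauchy: the quotient is killed by `2`).
So Delbourgo's intrinsic `ℓ`-factor is a `p`-adic UNIT on every (G-ord, `e = 2`) row: the kernel
replacement for the non-anomalous hypothesis `hna` of the cell's rank-`1` end states (TARGET S36‴ (T4)).

References: B. Mazur, Invent. Math. 18 (1972) 183–266, Cor. 5.15 with Remark p. 229, (5.6), §4
[Mazur1972Towers]; D. Delbourgo, J. Number Theory 95 (2002) 38–71, p. 61, p. 67 (iv), p. 69
[Delbourgo2002]; D. Delbourgo, Compositio Math. 113 (1998) §2.2 (finiteness of the index)
[Delbourgo1998]; J. H. Silverman, *AEC* 2nd ed., X.5 Cor. 5.4 [SilvermanAEC2009]; J.-P. Serre, *A Course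
in Arithmetic*, II §3.3 (squares in `ℚ_p`).
-/

noncomputable section

open scoped Classical

universe u

namespace Summit.BirchSwinnertonDyer.Rank1Residual.Additive.UniversalNormTwist

open WeierstrassCurve Field Literature.NumberTheory.EllipticCurves

variable {K : Type u} [Field K] {E : Type u} [Field E] [Algebra K E]

section Main

variable (X : WeierstrassCurve K) {d : K} {θ : AlgebraicClosure E}
  (hθ : ∀ σ : absoluteGaloisGroup E, σ • θ = θ ∨ σ • θ = -θ)
  (ι : localPoints (X.quadraticTwist d) E ≃+ localPoints X E)
  (hι₁ : ∀ σ : absoluteGaloisGroup E, σ • θ = θ →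
    ∀ P : localPoints (X.quadraticTwist d) E, ι (σ • P) = σ • ι P)
  (hι₂ : ∀ σ : absoluteGaloisGroup E, σ • θ = -θ →
    ∀ P : localPoints (X.quadraticTwist d) E, ι (σ • P) = -(σ • ι P))
  {p : ℕ} [Fact p.Prime] (κ : ZpExtension K p) (hp2 : p ≠ 2)



/-! ### §7.5 Step B: every `K_𝔭`-point is a `ℚ_p`-point modulo universal norms over `K_𝔭` -/

include hθ hp2 in
/-- **Step B.** If `[E(ℚ_p) : N_∞^{ℚ_p}] = [E(K_𝔭) : N_∞^{K_𝔭}] = N₀` is odd, every point of `E(K_𝔭)` is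
congruent to a point of `E(ℚ_p)` modulo `N_∞^{K_𝔭}` (the injection `E(ℚ_p)/N_∞^{ℚ_p} ↪ E(K_𝔭)/N_∞^{K_𝔭}`
of Step A is a bijection of finite sets of the same size). [folklore] -/
theorem exists_top_sub_mem_universalNorms_stabilizer [(MulAction.stabilizer (absoluteGaloisGroup E) θ).Normal] (hτ :
    ∃ τ : absoluteGaloisGroup E, τ • θ ≠ θ)
    {N₀ : ℕ} (hodd : Odd N₀) (htop : localUniversalNormIndex E κ ⊤ (W := X) = N₀)
    (hstab : localUniversalNormIndex E κ (MulAction.stabilizer (absoluteGaloisGroup E) θ) (W := X) = N₀) (z :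
        localFixedPoints X E (MulAction.stabilizer (absoluteGaloisGroup E) θ)) :
    ∃ m : localFixedPoints X E ⊤,
      z - AddSubgroup.inclusion (localFixedPoints_antitone le_top) m ∈
        localUniversalNorms E κ (MulAction.stabilizer (absoluteGaloisGroup E) θ) (W := X) := by
  refine exists_sub_map_mem_of_index_eq _ _ _ (fun a ↦ ?_) (by
    change localUniversalNormIndex E κ ⊤ (W := X) = localUniversalNormIndex E κ (MulAction.stabilizer
        (absoluteGaloisGroup E) θ) (W := X)
    rw [htop, hstab]) (by
    change localUniversalNormIndex E κ (MulAction.stabilizer (absoluteGaloisGroup E) θ) (W := X) ≠ 0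
    rw [hstab]; rintro rfl; exact Nat.not_odd_zero hodd) z
  have hodd' : Odd (localUniversalNormIndex E κ ⊤ (W := X)) := by rwa [htop]
  exact (mem_universalNorms_top_iff_stabilizer X hθ κ hp2 hτ hodd' a.2).symm

/-! ### §7.6 Step C: the `ℚ_p`-points of the twist are universal norms over `K_𝔭` -/

/-- `N_∞^{K_𝔭}` is stable under every `τ ∈ Γ_E`. [folklore] -/
theorem smul_mem_universalNorms_stabilizer [(MulAction.stabilizer (absoluteGaloisGroup E) θ).Normal] (τ :
    absoluteGaloisGroup E) {x : localPoints X E}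
    (hx : x ∈ localFixedPoints X E (MulAction.stabilizer (absoluteGaloisGroup E) θ))
    (hN : (⟨x, hx⟩ : localFixedPoints X E (MulAction.stabilizer (absoluteGaloisGroup E) θ)) ∈ localUniversalNorms E κ
        (MulAction.stabilizer (absoluteGaloisGroup E) θ) (W := X)) :
    (⟨τ • x, smul_mem_localFixedPoints_of_normal X (MulAction.stabilizer (absoluteGaloisGroup E) θ) τ hx⟩ :
        localFixedPoints X E (MulAction.stabilizer (absoluteGaloisGroup E) θ)) ∈
      localUniversalNorms E κ (MulAction.stabilizer (absoluteGaloisGroup E) θ) (W := X) := by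
  rw [mem_localUniversalNorms_iff] at hN ⊢
  intro n
  haveI := normal_localLayer_stabilizer κ (θ := θ) n
  obtain ⟨w, hw⟩ := hN n
  refine ⟨⟨τ • (w : localPoints X E), smul_mem_localFixedPoints_of_normal X _ τ w.2⟩, Subtype.ext ?_⟩
  rw [coe_localNorm_smul X (MulAction.stabilizer (absoluteGaloisGroup E) θ) _ τ (w : localPoints X E) w.2,
      Subtype.coe_eta, hw]

include hθ hp2 hι₁ hι₂ in
/-- **Step C.** Under the hypotheses of Step B, for every `ℚ_p`-point `P` of the twist, `ι P` (an
anti-invariant point of `E(K_𝔭)`) is a universal norm over `K_𝔭`: writing `ι P ≡ m` with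
`m ∈ E(ℚ_p)` and applying an involution `τ`, `-ι P ≡ m`, so `2 ι P ∈ N_∞^{K_𝔭}`, an odd-index
subgroup. [folklore] -/
theorem untwist_mem_universalNorms_stabilizer [(MulAction.stabilizer (absoluteGaloisGroup E) θ).Normal] (hτ : ∃ τ :
    absoluteGaloisGroup E, τ • θ ≠ θ)
    {N₀ : ℕ} (hodd : Odd N₀) (htop : localUniversalNormIndex E κ ⊤ (W := X) = N₀)
    (hstab : localUniversalNormIndex E κ (MulAction.stabilizer (absoluteGaloisGroup E) θ) (W := X) = N₀)
    {P : localPoints (X.quadraticTwist d) E} (hP : P ∈ localFixedPoints (X.quadraticTwist d) E ⊤) :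
    (⟨ι P, untwist_mem_localFixedPoints_stabilizer X ι hι₁ hP⟩ :
        localFixedPoints X E (MulAction.stabilizer (absoluteGaloisGroup E) θ)) ∈ localUniversalNorms E κ
            (MulAction.stabilizer (absoluteGaloisGroup E) θ) (W := X) := by
  set z : localFixedPoints X E (MulAction.stabilizer (absoluteGaloisGroup E) θ) :=
    ⟨ι P, untwist_mem_localFixedPoints_stabilizer X ι hι₁ hP⟩ with hz_def
  obtain ⟨m, hm⟩ := exists_top_sub_mem_universalNorms_stabilizer X hθ κ hp2 hτ hodd htop hstab z
  obtain ⟨τ₀, hτ₀⟩ := hτ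
  have hτθ : τ₀ • θ = -θ := (hθ τ₀).resolve_left hτ₀
  set y : localFixedPoints X E (MulAction.stabilizer (absoluteGaloisGroup E) θ) := z - AddSubgroup.inclusion
      (localFixedPoints_antitone le_top) m
    with hy_def
  have hτy := smul_mem_universalNorms_stabilizer X κ τ₀ y.2 (by rw [Subtype.coe_eta]; exact hm)
  have h2 : (2 : ℕ) • z = y - ⟨τ₀ • (y : localPoints X E), smul_mem_localFixedPoints_of_normal X
      (MulAction.stabilizer (absoluteGaloisGroup E) θ) τ₀ y.2⟩ := by
    apply Subtype.ext
    have hτm : τ₀ • ((m : localFixedPoints X E ⊤) : localPoints X E) = m := m.2 τ₀ (Subgroup.mem_top τ₀)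
    simp only [hy_def, hz_def, AddSubgroupClass.coe_sub, AddSubgroup.coe_add,
      AddSubgroup.coe_inclusion, smul_sub, hτm, smul_untwist_eq_neg X ι hι₂ hP hτθ,
      sub_sub_sub_cancel_right, sub_neg_eq_add, two_nsmul]
  have hodd' : Odd (localUniversalNorms E κ (MulAction.stabilizer (absoluteGaloisGroup E) θ) (W := X)).index := by
    change Odd (localUniversalNormIndex E κ (MulAction.stabilizer (absoluteGaloisGroup E) θ) (W := X)); rwa [hstab]
  exact mem_of_two_nsmul_mem_of_odd_index _ hodd' (h2 ▸ AddSubgroup.sub_mem _ hm hτy)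

/-! ### §7.7 Step D: the theorem -/

include hθ hp2 hι₁ hι₂ in
/-- **T3 — the twist transport of universal norms (abstract form).** Let `X/K` be a Weierstrass model,
`E ⊇ K` a field, `θ ∈ K̄_E` with `σ θ = ±θ` for all `σ ∈ Γ_E` and `θ ∉ E` (stabiliser `S = Γ_{E(θ)}`),
`ι : X^{(d)}(K̄_E) ≃+ X(K̄_E)` an additive isomorphism with the sign rule `ι(σP) = ±σ ι(P)` according
as `σθ = ±θ`, `κ` a `ℤ_p`-extension of `K` with `p` odd. If the universal norm indices of `X` over `E`
(`U = Γ_E`) and over `E(θ)` (`U = S`) are EQUAL AND ODD, then for every `E`-rational point `P` of the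
twist `X^{(d)}`, `2P` is a universal norm: `2 · X^{(d)}(E) ⊆ N_∞(X^{(d)}/E)`. [folklore] -/
theorem two_nsmul_mem_localUniversalNorms_twist (hτ : ∃ τ : absoluteGaloisGroup E, τ • θ ≠ θ) {N₀ : ℕ} (hodd : Odd N₀)
    (htop : localUniversalNormIndex E κ ⊤ (W := X) = N₀)
    (hstab : localUniversalNormIndex E κ (MulAction.stabilizer (absoluteGaloisGroup E) θ) (W := X) = N₀)
    (P : localFixedPoints (X.quadraticTwist d) E ⊤) :
    (2 : ℕ) • P ∈ localUniversalNorms E κ ⊤ (W := X.quadraticTwist d) := by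
  haveI : (MulAction.stabilizer (absoluteGaloisGroup E) θ).Normal := normal_stabilizer hθ
  rw [mem_localUniversalNorms_iff]
  intro n
  haveI := normal_localLayer_stabilizer κ (θ := θ) n
  -- `z = ι P` is a universal norm over `K_𝔭` (Step C); take a preimage `w` at layer `n`
  have hz := untwist_mem_universalNorms_stabilizer X hθ ι hι₁ hι₂ κ hp2 hτ hodd htop hstab P.2
  obtain ⟨w, hw⟩ := (mem_localUniversalNorms_iff _ _ _ _).mp hz n
  -- an involution `τ` of the layer, and the anti-symmetrised preimage `w' = w - τ w`
  obtain ⟨τ, hτL, hτθ⟩ := exists_mem_layer_smul_eq_neg hθ κ hp2 hτ n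
  have hτw : τ • (w : localPoints X E) ∈ localFixedPoints X E (localLayer E κ (MulAction.stabilizer
      (absoluteGaloisGroup E) θ) n) :=
    smul_mem_localFixedPoints_of_normal X _ τ w.2
  have hτ2 : τ * τ ∈ localLayer E κ (MulAction.stabilizer (absoluteGaloisGroup E) θ) n :=
    (mem_localLayer_stabilizer_iff κ).mpr ⟨by rw [← pow_two]; exact sq_mem_stabilizer hτθ,
      Subgroup.mul_mem _ hτL hτL⟩
  have hw' : (w : localPoints X E) - τ • (w : localPoints X E) ∈
      localFixedPoints X E (localLayer E κ (MulAction.stabilizer (absoluteGaloisGroup E) θ) n) := AddSubgroup.sub_mem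
          _ w.2 hτw
  have hτw' : τ • ((w : localPoints X E) - τ • (w : localPoints X E)) =
      -((w : localPoints X E) - τ • (w : localPoints X E)) := by
    rw [smul_sub, ← mul_smul, w.2 _ hτ2, neg_sub]
  -- `w'` descends to a `Γ_n`-fixed point `P'` of the twist
  have hP' := symm_mem_localFixedPoints_localLayer X hθ ι hι₁ hι₂ κ hw' hτL hτθ hτw'
  refine ⟨⟨_, hP'⟩, Subtype.ext ((ι).injective ?_)⟩
  -- whose norm is `2P`: `ι N(P') = N^{K_𝔭}(w') = z - τ z = 2 z = ι (2P)`
  rw [untwist_localNorm_top X hθ ι hι₁ κ hp2 n _ hP']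
  have hval : (⟨ι ((ι).symm
        ((w : localPoints X E) - τ • (w : localPoints X E))),
      untwist_mem_localFixedPoints_localLayer X ι hι₁ κ hP'⟩ :
        localFixedPoints X E (localLayer E κ (MulAction.stabilizer (absoluteGaloisGroup E) θ) n)) =
      w - ⟨τ • (w : localPoints X E), hτw⟩ :=
    Subtype.ext (by
      change ι ((ι).symm _) =
        (w : localPoints X E) - τ • (w : localPoints X E)
      rw [AddEquiv.apply_symm_apply])
  rw [hval, map_sub, AddSubgroupClass.coe_sub, coe_localNorm_smul X (MulAction.stabilizer (absoluteGaloisGroup E) θ)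
      _ τ (w : localPoints X E) w.2,
    Subtype.coe_eta, hw, smul_untwist_eq_neg X ι hι₂ P.2 hτθ, sub_neg_eq_add,
    AddSubmonoidClass.coe_nsmul, map_nsmul, two_nsmul]

end Main

/-! ## §8 Over `ℚ`: the additive twist `E = V ⊗ χ_{p*}` of a good ORDINARY curve `V` at an odd `p` -/

section Rat

open scoped NumberField
open IsDedekindDomain NumberField

variable {p : ℕ} [Fact p.Prime]

/-- **`p*` is not a square in `ℚ_p`**: `ord_p(p*) = 1` is odd. [folklore] -/
theorem not_isSquare_pStar (v : HeightOneSpectrum (𝓞 ℚ)) (hv : ((p : ℕ) : 𝓞 ℚ) ∈ v.asIdeal) :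
    ¬ IsSquare (algebraMap ℚ (v.adicCompletion ℚ) ((-1 : ℚ) ^ (p / 2) * p)) := by
  refine Literature.NumberTheory.NumberFields.not_isSquare_adicCompletion_of_odd_log_valuation v
    (mul_ne_zero (pow_ne_zero _ (by norm_num)) (by exact_mod_cast (Fact.out : p.Prime).ne_zero)) ?_
  have hp : v.valuation ℚ (p : ℚ) = WithZero.exp (-1 : ℤ) := by
    have h := Literature.NumberTheory.GaloisRepresentations.Rat.valuation_natGenerator v
    rwa [Literature.NumberTheory.GaloisRepresentations.Rat.natGenerator_eq_of_prime_mem v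
      (Fact.out : p.Prime) hv] at h
  rw [Valuation.map_mul, Valuation.map_pow, Valuation.map_neg, Valuation.map_one, one_pow, one_mul,
    hp, WithZero.log_exp]
  decide

omit [Fact p.Prime] in
/-- **Some `σ ∈ Γ_F` moves `√d` when `d ∈ F` is not a square** (`F` of characteristic `0`): otherwise
`√d ∈ F̄^{Γ_F} = F` (Mathlib `InfiniteGalois.mem_range_algebraMap_iff_fixed`). [folklore] -/
theorem exists_smul_geomSqrt_ne_of_not_isSquare {F : Type*} [Field F] [CharZero F] {d : F}
    (hd : ¬ IsSquare d) : ∃ σ : absoluteGaloisGroup F, σ • geomSqrt d ≠ geomSqrt d := by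
  by_contra h
  push Not at h
  have hfix : ∀ e : AlgebraicClosure F ≃ₐ[F] AlgebraicClosure F, e (geomSqrt d) = geomSqrt d :=
    fun e ↦ by
      have he := h ((absoluteGaloisGroup.toAlgEquiv F).symm e)
      rwa [absoluteGaloisGroup.toAlgEquiv_symm_apply] at he
  obtain ⟨r, hr⟩ := (InfiniteGalois.mem_range_algebraMap_iff_fixed (geomSqrt d)).mpr hfix
  apply hd
  refine ⟨r, (algebraMap F (AlgebraicClosure F)).injective ?_⟩
  rw [map_mul, hr, ← sq, geomSqrt_sq]

/-- **Some `τ ∈ Γ_{ℚ_p}` moves `√p*`** (`p*` is not a square in `ℚ_p`). [folklore] -/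
theorem exists_smul_geomSqrt_pStar_ne (v : HeightOneSpectrum (𝓞 ℚ)) (hv : ((p : ℕ) : 𝓞 ℚ) ∈ v.asIdeal) :
    ∃ τ : absoluteGaloisGroup (v.adicCompletion ℚ),
      τ • geomSqrt (algebraMap ℚ (v.adicCompletion ℚ) ((-1 : ℚ) ^ (p / 2) * p)) ≠
        geomSqrt (algebraMap ℚ (v.adicCompletion ℚ) ((-1 : ℚ) ^ (p / 2) * p)) := by
  haveI : CharZero (v.adicCompletion ℚ) :=
    charZero_of_injective_algebraMap (algebraMap ℚ (v.adicCompletion ℚ)).injective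
  exact exists_smul_geomSqrt_ne_of_not_isSquare (not_isSquare_pStar v hv)

variable (V W : WeierstrassCurve ℚ) [V.IsElliptic] [V.IsGloballyMinimal] (κ : ZpExtension ℚ p)
  (v : HeightOneSpectrum (𝓞 ℚ))

omit [Fact p.Prime] in
/-- `θ = √p* ∈ ℚ̄_p` squares to `p*` seen in `ℚ̄_p` (scalar tower `ℚ → ℚ_p → ℚ̄_p`). [folklore] -/
theorem geomSqrt_pStar_sq :
    geomSqrt (algebraMap ℚ (v.adicCompletion ℚ) ((-1 : ℚ) ^ (p / 2) * p)) ^ 2 =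
      algebraMap ℚ (AlgebraicClosure (v.adicCompletion ℚ)) ((-1 : ℚ) ^ (p / 2) * p) := by
  rw [geomSqrt_sq, ← IsScalarTower.algebraMap_apply]

/-- `θ = √p* ≠ 0`. [folklore] -/
theorem geomSqrt_pStar_ne_zero :
    geomSqrt (algebraMap ℚ (v.adicCompletion ℚ) ((-1 : ℚ) ^ (p / 2) * p)) ≠ 0 :=
  geomSqrt_ne_zero ((map_ne_zero _).mpr
    (mul_ne_zero (pow_ne_zero _ (by norm_num)) (by exact_mod_cast (Fact.out : p.Prime).ne_zero)))

omit [V.IsElliptic] [V.IsGloballyMinimal] in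
/-- The `Γ_{ℚ_p}`-equivariant identification of the local points of `V` and of its completed-square
model `V^{(1)} = C₁ • V`. [folklore] -/
theorem exists_equivariant_quadraticTwist_one :
    ∃ φ : localPoints V (v.adicCompletion ℚ) ≃+ localPoints (V.quadraticTwist 1) (v.adicCompletion ℚ),
      ∀ (σ : absoluteGaloisGroup (v.adicCompletion ℚ)) (P : localPoints V (v.adicCompletion ℚ)),
        φ (σ • P) = σ • φ P := by
  obtain ⟨C₁, hC₁⟩ := V.exists_variableChange_quadraticTwist_one
  exact ⟨(V.localPointsEquiv C₁ _).trans (localPointsCongr _ hC₁), fun σ P ↦ by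
    rw [AddEquiv.trans_apply, AddEquiv.trans_apply, localPointsEquiv_smul, localPointsCongr_smul]⟩

variable {V W} in
omit [V.IsElliptic] [V.IsGloballyMinimal] in
/-- The `Γ_{ℚ_p}`-equivariant identification of the local points of `(V^{(1)})^{(d)}` and of
`W = C • V^{(d)}`. [folklore] -/
theorem exists_equivariant_twist {d : ℚ} {C : VariableChange ℚ} (hC : C • V.quadraticTwist d = W) :
    ∃ φ : localPoints ((V.quadraticTwist 1).quadraticTwist d) (v.adicCompletion ℚ) ≃+
        localPoints W (v.adicCompletion ℚ),
      ∀ (σ : absoluteGaloisGroup (v.adicCompletion ℚ))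
        (P : localPoints ((V.quadraticTwist 1).quadraticTwist d) (v.adicCompletion ℚ)),
        φ (σ • P) = σ • φ P := by
  have h1 : (V.quadraticTwist 1).quadraticTwist d = V.quadraticTwist d := by
    rw [quadraticTwist_quadraticTwist, one_mul]
  exact ⟨(localPointsCongr _ h1).trans (((V.quadraticTwist d).localPointsEquiv C _).trans
      (localPointsCongr _ hC)), fun σ P ↦ by
    rw [AddEquiv.trans_apply, AddEquiv.trans_apply, AddEquiv.trans_apply, AddEquiv.trans_apply,
      localPointsCongr_smul, localPointsEquiv_smul, localPointsCongr_smul]⟩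

/-- **T3 over `ℚ` — universal norms of the additive twist.** Let `V/ℚ` be globally minimal with good
ORDINARY reduction at an odd prime `p`, `W = C • V^{(p*)}` a model of its twist by
`p* = (−1)^{(p−1)/2} p` (so `W` has additive, potentially good ordinary reduction of defect `2` at `p`),
`κ` the cyclotomic `ℤ_p`-extension, `v` the place above `p`. GRANTED Mazur 1972 Cor. 5.15 in the tree's
form (`Mazur1972.cor515_universalNormIndex`: the universal norm index of `V` is `p^{2e_p}` both over
`ℚ_p` and over `ℚ_p(√p*)`), every `ℚ_p`-point `P` of `W` has `2P ∈ N_∞W(ℚ_p)`: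
**`2 · W(ℚ_p) ⊆ N_∞(W/ℚ_p)`**. [cite: Mazur1972Towers, Cor. 5.15 with Remark (p. 229)]
[cite: Delbourgo2002, p. 61 (Remark), p. 69] -/
theorem two_nsmul_mem_localUniversalNorms_of_goodOrd_twist
    (hMaz : Mazur1972.cor515_universalNormIndex) (hp2 : p ≠ 2)
    (hgood : V.HasGoodReductionAtPrime p) (hord : ¬ ((p : ℕ) : ℤ) ∣ V.frobeniusTrace p)
    (hκ : κ.IsCyclotomic) (hv : ((p : ℕ) : 𝓞 ℚ) ∈ v.asIdeal)
    {C : VariableChange ℚ} (hC : C • V.quadraticTwist ((-1 : ℚ) ^ (p / 2) * p) = W)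
    (P : localFixedPoints W (v.adicCompletion ℚ) ⊤) :
    (2 : ℕ) • P ∈ localUniversalNorms (v.adicCompletion ℚ) κ ⊤ (W := W) := by
  -- Mazur's two indices, transported to the completed-square model `X = V^{(1)}`
  set θ := geomSqrt (algebraMap ℚ (v.adicCompletion ℚ) ((-1 : ℚ) ^ (p / 2) * p)) with hθ_def
  set N₀ : ℕ := p ^ (2 * (if ((p : ℕ) : ℤ) ∣ V.frobeniusTrace p - 1 then 1 else 0)) with hN₀_def
  have hodd : Odd N₀ := ((Fact.out : p.Prime).odd_of_ne_two hp2).pow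
  have htopV : localUniversalNormIndex (W := V) (v.adicCompletion ℚ) κ ⊤ = N₀ :=
    hMaz V p hp2 hgood hord κ hκ v hv ⊤ (Or.inl rfl)
  have hstabV : localUniversalNormIndex (W := V) (v.adicCompletion ℚ) κ
      (MulAction.stabilizer (absoluteGaloisGroup (v.adicCompletion ℚ)) θ) = N₀ :=
    hMaz V p hp2 hgood hord κ hκ v hv _ (Or.inr rfl)
  obtain ⟨φ₁, hφ₁⟩ := exists_equivariant_quadraticTwist_one V v
  have htop : localUniversalNormIndex (W := V.quadraticTwist 1) (v.adicCompletion ℚ) κ ⊤ = N₀ := by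
    rw [← localUniversalNormIndex_eq φ₁ hφ₁ κ ⊤, htopV]
  have hstab : localUniversalNormIndex (W := V.quadraticTwist 1) (v.adicCompletion ℚ) κ
      (MulAction.stabilizer (absoluteGaloisGroup (v.adicCompletion ℚ)) θ) = N₀ := by
    rw [← localUniversalNormIndex_eq φ₁ hφ₁ κ _, hstabV]
  -- the abstract transport on `X^{(p*)}`, then transport to `W = C • V^{(p*)}`
  haveI : (V.quadraticTwist 1).IsCharNeTwoNF := ⟨rfl, rfl⟩
  obtain ⟨φ, hφ⟩ := exists_equivariant_twist v hC
  have hmain := two_nsmul_mem_localUniversalNorms_twist (V.quadraticTwist 1)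
    (fun σ ↦ smul_geomSqrt_eq_or σ _)
    (@id (localPoints ((V.quadraticTwist 1).quadraticTwist ((-1 : ℚ) ^ (p / 2) * p))
        (v.adicCompletion ℚ) ≃+ localPoints (V.quadraticTwist 1) (v.adicCompletion ℚ))
      (untwistEquivAt (V.quadraticTwist 1) (geomSqrt_pStar_sq v) (geomSqrt_pStar_ne_zero v)))
    (fun σ hσ Q ↦ untwist_smul_of_eq _ (geomSqrt_pStar_sq v) (geomSqrt_pStar_ne_zero v) σ hσ Q)
    (fun σ hσ Q ↦ untwist_smul_of_eq_neg _ (geomSqrt_pStar_sq v) (geomSqrt_pStar_ne_zero v) σ hσ Q)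
    κ hp2 (exists_smul_geomSqrt_pStar_ne v hv) hodd htop hstab
    ⟨φ.symm P, (map_mem_localFixedPoints_iff φ.symm (symm_smul φ hφ) ⊤ (P : localPoints W _)).mpr P.2⟩
  have hback := map_mem_localUniversalNorms φ hφ κ ⊤ _ hmain
  convert hback using 1
  exact Subtype.ext (by
    change (2 : ℕ) • (P : localPoints W (v.adicCompletion ℚ)) =
      φ ((2 : ℕ) • φ.symm (P : localPoints W (v.adicCompletion ℚ)))
    rw [map_nsmul, φ.apply_symm_apply])

/-- **Corollary: the universal norm index of the additive twist is prime to `p`.** In the setting of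
`two_nsmul_mem_localUniversalNorms_of_goodOrd_twist`, if the index `[W(ℚ_p) : N_∞W(ℚ_p)]` is finite
(nonzero — Delbourgo 1998 §2.2 Lemma / 2002 p. 69, the printed finiteness carried by
`Delbourgo2002.mainTheorem_intrinsic`), then `p` does NOT divide it: the quotient is killed by `2`, so
an element of order `p` (Cauchy) would force `p ∣ 2`. Hence Delbourgo's intrinsic factor
`[E(ℚ_p) : N_∞E(ℚ_p)]` is a `p`-adic UNIT on every additive potentially-good-ordinary row of defect `2`,
anomalous or not. [cite: Mazur1972Towers, Cor. 5.15 with Remark (p. 229)] [cite: Delbourgo2002, p. 67 (iv), p. 69] -/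
theorem not_dvd_localUniversalNormIndex_of_goodOrd_twist
    (hMaz : Mazur1972.cor515_universalNormIndex) (hp2 : p ≠ 2)
    (hgood : V.HasGoodReductionAtPrime p) (hord : ¬ ((p : ℕ) : ℤ) ∣ V.frobeniusTrace p)
    (hκ : κ.IsCyclotomic) (hv : ((p : ℕ) : 𝓞 ℚ) ∈ v.asIdeal)
    {C : VariableChange ℚ} (hC : C • V.quadraticTwist ((-1 : ℚ) ^ (p / 2) * p) = W)
    (h0 : localUniversalNormIndex (W := W) (v.adicCompletion ℚ) κ ⊤ ≠ 0) :
    ¬ p ∣ localUniversalNormIndex (W := W) (v.adicCompletion ℚ) κ ⊤ := by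
  intro hdvd
  set N := localUniversalNorms (v.adicCompletion ℚ) κ ⊤ (W := W) with hN_def
  change N.index ≠ 0 at h0
  change p ∣ N.index at hdvd
  haveI : Finite (localFixedPoints W (v.adicCompletion ℚ) ⊤ ⧸ N) :=
    Nat.finite_of_card_ne_zero (by rwa [← AddSubgroup.index_eq_card])
  letI := Fintype.ofFinite (localFixedPoints W (v.adicCompletion ℚ) ⊤ ⧸ N)
  have hcard : p ∣ Fintype.card (localFixedPoints W (v.adicCompletion ℚ) ⊤ ⧸ N) := by
    rwa [Fintype.card_eq_nat_card, ← AddSubgroup.index_eq_card]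
  obtain ⟨q, hq⟩ := exists_prime_addOrderOf_dvd_card p hcard
  obtain ⟨P, rfl⟩ := QuotientAddGroup.mk_surjective q
  have h2 : (2 : ℕ) • (QuotientAddGroup.mk P : localFixedPoints W (v.adicCompletion ℚ) ⊤ ⧸ N) = 0 := by
    rw [← QuotientAddGroup.mk_nsmul, QuotientAddGroup.eq_zero_iff]
    exact two_nsmul_mem_localUniversalNorms_of_goodOrd_twist V W κ v hMaz hp2 hgood hord hκ hv hC P
  have hp2' : p ∣ 2 := hq ▸ addOrderOf_dvd_iff_nsmul_eq_zero.mpr h2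
  exact hp2 ((Nat.prime_dvd_prime_iff_eq (Fact.out : p.Prime) Nat.prime_two).mp hp2')

end Rat

end Summit.BirchSwinnertonDyer.Rank1Residual.Additive.UniversalNormTwist

end
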